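import Mathlib
import HarnessLib
import HarnessLib.Audit
import Summits.CriticalPhenomena.Statement
import Literature.Probability.RandomPlanarGeometry.HullSubdomainPullback
import Literature.Probability.RandomPlanarGeometry.HexSAW
import Summits.CriticalPhenomena.SAWScalingLimit.Theorems.SAWLoopFugacityFlowAvoidanceDeterminesLaw
import Summits.CriticalPhenomena.SAWScalingLimit.Theorems.SAWLoopFugacityFlowSLECarrier
import Summits.CriticalPhenomena.SAWScalingLimit.Theorems.SAWSteinDefectSLEAvoidanceValue

/-!
Route: SAWLatticeVirasoro

# Route SAWLatticeVirasoro — emergent c=0 Virasoro of the n=0 honeycomb transfer matrix, Ward +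
Hadamard to the 5/8 restriction law on Hex, then avoidance closing and universality

It suffices to show X_V = (R_H) ∧ (S_H) ∧ (T_H) ∧ (U) [idea card lattice-virasoro-koo-saleur:
conformal symmetry of the
critical honeycomb SAW as an EMERGENT OPERATOR ALGEBRA — Koo–Saleur lattice Virasoro modes of the n
= 0 dilute
Temperley–Lieb transfer matrix, c = 0 Ward identities, the 5/8-law by integrating T]:
(R_H) HexRestrictionLaw — the typed face of the card's chain (V1 spectrum) → (V2 lattice Virasoro) →
(V3 boundary Ward
identity, h = h_(2,1) = 5/8, c = 0) → (V4 Hadamard variation): for every Dobrushin domain (D; a, b),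
every hull subdomain
D' ⊆ D (same marked points, agreeing with D near a and b), every hexagonal endpoint approximation
and every chordal
uniformizer φ with restriction data (Φ_A, d = Φ'_A(0)) of A = φ.pullbackHull D', the critical
hexagonal SAW probability
P^Hex_δ(range γ_δ ⊆ cl D') converges to d^(5/8) as δ → 0+ — Lawler–Schramm–Werner's restriction law,
on the lattice where
the walk is Yang–Baxter integrable; the mechanism cruxes KooSaleurVirasoro (V2), WardHadamard (V3 ⇒
V4) and ConformalTowers
(V1) are filed informally right after open (they need the definitions listed below) and become the
glued split of R_H.
(S_H) HexSimpleSubseqLimits — subsequential weak limits of the hexagonal laws are carried by simple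
chords from a to b
meeting ∂D only at a, b. (T_H) HexEventualTight — eventual tightness (shared item
stmt-CriticalPhenomena-4997).
(U) LatticeUniversality — square- and hexagonal-lattice critical SAW laws are asymptotically equal
on bounded continuous
test functions (shared item stmt-CriticalPhenomena-0807).
Lean: `(∀ (D D' : Literature.Probability.RandomPlanarGeometry.DobrushinDomain) (a b : ℝ →
Literature.Probability.LatticeModels.HexVertex),
Literature.Probability.RandomPlanarGeometry.SAW.IsEmbEndpointApprox
Literature.Probability.LatticeModels.hexGraph Literature.Probability.LatticeModels.hexCenter D a b →
D'.carrier ⊆ D.carrier → D'.pt 0 = D.pt 0 → D'.pt 1 = D.pt 1 → (∃ ε : ℝ, 0 < ε ∧ D'.carrier ∩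
Metric.ball (D.pt 0) ε = D.carrier ∩ Metric.ball (D.pt 0) ε ∧ D'.carrier ∩ Metric.ball (D.pt 1) ε =
D.carrier ∩ Metric.ball (D.pt 1) ε) → ∀ (φ :
Literature.Probability.RandomPlanarGeometry.ConformalEquiv UpperHalfPlane.upperHalfPlaneSet
D.carrier), D.IsChordalUniformizing φ → ∀ (Φ :
Literature.Probability.RandomPlanarGeometry.ConformalEquiv (UpperHalfPlane.upperHalfPlaneSet \
φ.pullbackHull D') UpperHalfPlane.upperHalfPlaneSet) (d : ℝ),
Literature.Probability.RandomPlanarGeometry.IsRestrictionMap (φ.pullbackHull D') Φ →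
Literature.Probability.RandomPlanarGeometry.HasRestrictionDeriv (φ.pullbackHull D') Φ d →
Filter.Tendsto (fun δ => ((Literature.Probability.RandomPlanarGeometry.SAW.hexSAWLaw D.carrier δ (a
δ) (b δ)).map (fun γ => γ.curve))
(Literature.Probability.RandomPlanarGeometry.CurveClass.rangeSubset (closure D'.carrier)))
(nhdsWithin 0 (Set.Ioi 0)) (nhds (ENNReal.ofReal (d ^ ((5 : ℝ) / 8))))) ∧ (∀ (D :
Literature.Probability.RandomPlanarGeometry.DobrushinDomain) (a b : ℝ →
Literature.Probability.LatticeModels.HexVertex),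
Literature.Probability.RandomPlanarGeometry.SAW.IsEmbEndpointApprox
Literature.Probability.LatticeModels.hexGraph Literature.Probability.LatticeModels.hexCenter D a b →
∀ (s : ℕ → ℝ) (ν : MeasureTheory.Measure (Literature.Probability.RandomPlanarGeometry.CurveClass
ℂ)), Filter.Tendsto s Filter.atTop (nhdsWithin 0 (Set.Ioi 0)) → MeasureTheory.IsProbabilityMeasure ν
→ (∀ f : BoundedContinuousFunction (Literature.Probability.RandomPlanarGeometry.CurveClass ℂ) ℝ,
Filter.Tendsto (fun n => ∫ γ, f γ.curve ∂(Literature.Probability.RandomPlanarGeometry.SAW.hexSAWLaw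
D.carrier (s n) (a (s n)) (b (s n)))) Filter.atTop (nhds (∫ x, f x ∂ν))) → ∀ᵐ γ ∂ν, γ ∈
Literature.Probability.RandomPlanarGeometry.CurveClass.simple ∧ γ.source = D.pt 0 ∧ γ.target = D.pt
1 ∧ γ.range ⊆ closure D.carrier ∧ γ.range ∩ frontier D.carrier ⊆ {D.pt 0, D.pt 1}) ∧ (∀ (D :
Literature.Probability.RandomPlanarGeometry.DobrushinDomain) (a b : ℝ →
Literature.Probability.LatticeModels.HexVertex),
Literature.Probability.RandomPlanarGeometry.SAW.IsEmbEndpointApprox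
Literature.Probability.LatticeModels.hexGraph Literature.Probability.LatticeModels.hexCenter D a b →
∃ δ₀ : ℝ, 0 < δ₀ ∧ MeasureTheory.IsTightMeasureSet ((fun δ : ℝ =>
(Literature.Probability.RandomPlanarGeometry.SAW.hexSAWLaw D.carrier δ (a δ) (b δ)).map (fun γ =>
γ.curve)) '' Set.Ioc 0 δ₀)) ∧ (∀ (D : Literature.Probability.RandomPlanarGeometry.DobrushinDomain)
(a b : ℝ → Literature.Probability.LatticeModels.Site 2) (a' b' : ℝ →
Literature.Probability.LatticeModels.HexVertex),
Literature.Probability.RandomPlanarGeometry.SAW.IsEndpointApprox D a b →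
Literature.Probability.RandomPlanarGeometry.SAW.IsEmbEndpointApprox
Literature.Probability.LatticeModels.hexGraph Literature.Probability.LatticeModels.hexCenter D a' b'
→ ∀ f : BoundedContinuousFunction (Literature.Probability.RandomPlanarGeometry.CurveClass ℂ) ℝ,
Filter.Tendsto (fun δ => (∫ γ, f γ.curve ∂(Literature.Probability.RandomPlanarGeometry.SAW.law
D.carrier δ (a δ) (b δ))) - ∫ γ, f γ.curve
∂(Literature.Probability.RandomPlanarGeometry.SAW.hexSAWLaw D.carrier δ (a' δ) (b' δ))) (nhdsWithin
0 (Set.Ioi 0)) (nhds 0))`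

## Assembly
Fix a Dobrushin domain and a square-lattice endpoint approximation; HexApproxExists gives a
hexagonal one. The hexagonal
laws are eventually probability measures (reachability; finitely many SAWs in a bounded Ω_δ). If the
test integral of some
bounded continuous f along the hexagonal laws did not converge to its SLE_(8/3) value, a sequence
δ_n → 0+ would keep it
ε away; HexEventualTight + Prokhorov (CurveClass ℂ Polish: CurveClass.polishSpace) extract a weakly
convergent
sub-subsequence with a probability limit ν. Identification: chordal uniformizers exist
(MarkedDomain.exists_isChordalUniformizing),
pulled-back hulls of hull subdomains are *-hulls with restriction maps and derivatives
(IsStarHull.pullbackHull,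
IsStarHull.exists_isRestrictionMap, IsStarHull.exists_hasRestrictionDeriv_holds — proved in the
tree), so HexRestrictionLaw
along δ_n and SLEAvoidanceValue give convergence of every hull-subdomain avoidance probability to
the SLE_(8/3) value;
HexAvoidancePassage turns this into ν = μ_SLE on all hull-subdomain avoidance events;
HexSimpleSubseqLimits and SLECarrier
supply the two carrier clauses; AvoidanceDeterminesLaw gives ν = μ_SLE = preWienerMeasure.map Γ
(exists_isSLECurve,
IsSLECurve.map_eq), contradiction. Hence TendstoLaw for the hexagonal laws; LatticeUniversality
transfers every test
integral to the square-lattice laws (two-ε argument); a.e.-measurability is automatic (discrete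
σ-algebra); so
ConvergesInLawToSLE (8/3), i.e. SAWScalingLimit. Standard measure theory — the same closing as
routes SAWLoopFugacityFlow
(on ℤ²) and SAWBetheAnsatz (hex tail), no new mathematics in the Assembly.
The Assembly decl lists the four proved library facts it leans on (Polish curve space, uniqueness in
law and existence of
chordal SLE_(8/3) curves, chordal uniformizers) followed by the closing supports and the cruxes;
restriction maps /
derivatives of pulled-back hulls exist by IsStarHull.exists_isRestrictionMap /
exists_hasRestrictionDeriv_holds and are used
inside the proof, not as hypotheses.

Rationale: WHY THIS LINE. Physicists do not see the conformal invariance of polymers in an observable: they see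
it in the OPERATOR CONTENT of the
transfer matrix — Koo–Saleur (KooSaleur1994, hep-th/9312156 §3: lattice modes l_n = (L/2π){−(γ/π sin
γ) Σ_j e^(injπ/L)(e_j −
e_∞ + (iγ/π sin γ)[e_j, e_(j+1)])} + (c/24)δ_(n,0) built from Temperley–Lieb densities, conjectured
to converge on scaling
states to Virasoro, "a representation of P Vir P"), its modern 'scaling-weak' form and numerics for
loop/Potts models
(doi:10.1007/jhep10(2020)109, doi:10.1007/jhep02(2021)130, MilstedVidal2017), the rigorous instances
for anyonic/free-fermion
chains (doi:10.1007/s00220-018-3254-1) and for the discrete GFF/Ising by discrete complex analysis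
(doi:10.1007/s00220-022-04475-x), and the c = 0 indecomposable structure of dilute polymers measured
on the lattice
(DubailJacobsenSaleur2010: b = 5/6). The honeycomb O(n) model at n = 0, x_c = 1/√(2+√2) is
Yang–Baxter integrable
(Nienhuis1982, Baxter1986, BatchelorBlote1988, BatchelorSuzuki1993), so its spectrum (V1) is a
Bethe-ansatz target and its
local densities generate a dilute Temperley–Lieb algebra at q = i on which lattice Virasoro modes
can be written. On the
continuum side, Friedrich–Werner and Doyon–Riva–Cardy (FriedrichWerner2003,
doi:10.1007/s00220-006-0106-1,
doi:10.1007/s11005-012-0594-1) identified the boundary stress tensor of restriction measures /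
SLE_(8/3) with rescaled
boundary-bump probabilities and derived the Ward identities whose integration (Hadamard variation;
at c = 0 the Schwarzian
term is absent and for SAW Z(D) ≡ 1) is exactly the restriction law Φ'_A(0)^(5/8)
(LawlerSchrammWerner2003Restriction
Thm 6.1, PROVED in the tree: sle_restriction_eightThirds_holds). Imported areas: representation
theory of non-semisimple
lattice algebras (TL/dTL, staggered Virasoro modules at c = 0), quantum integrability (BA control of
scaling states), BCFT
Ward identities / Hadamard variational calculus, conformal restriction (closing). What no filed
route does: the 23 sibling
routes use observables (SAWParafermion, SAWResidueField; barrier ParafermionicHalfCauchyRiemann),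
restriction axioms or
rigidity on ℤ² (SAWConfRestriction, SAWRestrictionRigidity, SAWInfinitesimalRigidity), n- or
λ-continuation
(SAWLoopFugacityFlow, SAWChargeContinuation) or Bethe-ansatz NUMBERS (SAWBetheAnsatz: gaps 5/8, 5/48
only); none derives
conformal covariance from the lattice operator algebra. This route types the hexagonal restriction
law (the hex twin of
stmt-CriticalPhenomena-4981) as the hinge every hex-restriction line can share, and reaches ℤ² only
through the shared
universality crux (no identity is claimed on ℤ², barrier NienhuisWeightsExcludeVertexSAW); it never
quantifies over all δ
(negatives index: stmt-CriticalPhenomena-0772).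

RANKED CRUXES. #2 HexRestrictionLaw (crux) — (R_H) the LSW restriction law for the critical
hexagonal SAW — for every Dobrushin D, hull subdomain D' (D' ⊆ D, same marked points, D' ∩ B(a,ε) =
D ∩ B(a,ε) and likewise at b for some ε > 0), hexagonal endpoint approximation (a_δ, b_δ)
(IsEmbEndpointApprox hexGraph hexCenter), chordal uniformizing φ : ℍ → D and restriction data (Φ, d
= Φ'_A(0)) of A = φ.pullbackHull D', the probability under hexSAWLaw D δ a_δ b_δ that the curve's
range lies in closure D' tends to ENNReal.ofReal (d^(5/8)) as δ → 0+. Lattice meaning: Z_δ(Ω'_δ;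
a,b)/Z_δ(Ω_δ; a,b) (exact domain-restriction property of the x_c-weights) up to boundary-touching
walks and largest-component bookkeeping. Card item (V4) 'PFR(5/8)'; hex twin of
SAWLoopFugacityFlow.AvoidanceLimit (stmt-CriticalPhenomena-4981, on ℤ²). Delivered in this route by
ConformalTowers → KooSaleurVirasoro → WardHadamard (informal, see Two-layer plan); directly
attackable too (any hex method), and the cheapest thing for refuters to simulate. [difficulty:
open-problem] (why it might fail: Value and existence for EVERY IsEmbEndpointApprox:
mesoscopic-depth endpoints (Kennedy–Lawler lattice effects) or boundary-touching walks (closed event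
{range ⊆ cl D'} vs Z(Ω'_δ)/Z(Ω_δ)) could shift the limit; on Hex only x_c is a theorem, no exponent
is.) [LawlerSchrammWerner2004SAW, LawlerSchrammWerner2003Restriction, DuminilCopinSmirnov2012,
KennedyLawler2013, Kennedy2004, FriedrichWerner2003]
#6 LatticeUniversality (crux) — (U) (shared verbatim with routes SAWHexUniversality / SAWBetheAnsatz
/ SAWResidueField, item stmt-CriticalPhenomena-0807) for every Dobrushin domain, every
square-lattice endpoint approximation (a_δ, b_δ) and every hexagonal one (a'_δ, b'_δ), and every
bounded continuous f on CurveClass ℂ: ∫ f∘curve dP^(ℤ²)_δ − ∫ f∘curve dP^(Hex)_δ → 0 as δ → 0+. The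
card's last arrow ('route SAWHexUniversality's (U) carries it to ℤ²'); the ℤ²-direct variant of the
card (Milsted–Vidal generic extraction for the non-integrable ℤ² chain) is NOT filed. [difficulty:
open-problem] (why it might fail: Uniform ℤ² SAW is in no Yang–Baxter family (GlazmanManolescu2019
p.1; barrier NienhuisWeightsExcludeVertexSAW): no transfer tool reaches it; lattice effects persist
in limits of boundary SAW ensembles (KennedyLawler2013); needs tightness on both lattices.)
[GlazmanManolescu2019, KennedyLawler2013, DuminilCopinSmirnov2012,
Literature.Barriers.CriticalPhenomena.NienhuisWeightsExcludeVertexSAW]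
#9 HexSimpleSubseqLimits (support) — (S_H) for every Dobrushin domain, hexagonal endpoint
approximation, sequence s_n → 0+ and probability measure ν on CurveClass ℂ that is the weak limit of
the pushed-forward hexagonal SAW laws along s_n, ν-a.e. curve class is simple, runs from a = D.pt 0
to b = D.pt 1, has range in closure D and meets ∂D only at a, b (the carrier clause of
AvoidanceDeterminesLaw). Hex twin of SAWLoopFugacityFlow.SimpleSubseqLimits
(stmt-CriticalPhenomena-4982). Load-bearing and believed open (no-retracing / no-boundary-crawling
bounds at x_c are not in print, only sub-ballisticity); filed as support because value-free and not
specific to this line; foreseen inputs: HexRestrictionLaw + filled-range Lemma 3.2 + SLE_(8/3)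
simplicity for the 'simple boundary-avoiding range' half, a near-self-approach estimate
(ConformalTowers' 2-leg weight h_(3,1) = 2 is the CFT reason) for 'no retracing'. [difficulty:
open-problem] [LawlerSchrammWerner2004SAW, KennedyLawler2013, DuminilCopinHammond2013,
arXiv:2310.17299, AizenmanBurchard1999]
#9 HexEventualTight (support) — (T_H) (shared verbatim with SAWBetheAnsatz.HexEventualTight,
stmt-CriticalPhenomena-4997, a crux there) for every Dobrushin domain and hexagonal endpoint
approximation there is δ₀ > 0 such that the push-forwards to CurveClass ℂ of hexSAWLaw D δ a_δ b_δ,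
δ ∈ (0, δ₀], form a tight set — the ∃δ₀ form dictated by the refutation of the all-δ statement
stmt-CriticalPhenomena-0772. Load-bearing, believed open (Kemppainen–Smirnov G2 / Aizenman–Burchard
at x_c not in print); support here because shared and value-free; the CFT input this line would add
is the k-leg tower h_(k+1,1) → ∞ of ConformalTowers (arm exponents), not a proof. [difficulty:
open-problem] [KemppainenSmirnov2017, AizenmanBurchard1999, DuminilCopinHammond2013,
arXiv:2310.17299]
#9 HexAvoidancePassage (support) — portmanteau sandwich on Hex (twin of
SAWLoopFugacityFlow.AvoidancePassage, stmt-CriticalPhenomena-4984): if ν is the weak limit of the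
pushed-forward hexagonal SAW laws along s_n → 0+, μ is the chordal SLE_(8/3) law of D, and along s_n
the SAW avoidance probabilities of EVERY hull subdomain D'' converge to μ(range ⊆ closure D''), then
ν(range ⊆ closure D') = μ(range ⊆ closure D') for every hull subdomain D'. '≥': closed event
(CurveClass.isClosed_rangeSubset); '≤': approximate D' from outside by hull super-domains, open
events (isOpen_rangeSubset), lattice curves live in cl D, continuity from above of μ (or kernel
continuity of Φ'_A(0)). Planar topology + measure theory. [difficulty: M]
[LawlerSchrammWerner2003Restriction, AizenmanBurchard1999]
#9 SLECarrier (support) — (shared verbatim with SAWLoopFugacityFlow.SLECarrier,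
stmt-CriticalPhenomena-4985) the chordal SLE_(8/3) law of a Dobrushin domain is a probability
measure carried by simple curve classes from a to b with range in closure D meeting ∂D only at a, b
(Rohde–Schramm simplicity for κ ≤ 4, transience, boundary avoidance; in tree
IsSLELaw.isProbabilityMeasure / ae_simple / ae_endpoints). [difficulty: provable-now]
[RohdeSchramm2005, LawlerSchrammWerner2003Restriction, Lawler2005]
#9 SLEAvoidanceValue (support) — (shared verbatim with SAWLoopFugacityFlow.SLEAvoidanceValue,
stmt-CriticalPhenomena-4986) LSW03 Thm 6.1 transposed to hull subdomains: for μ the chordal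
SLE_(8/3) law of D, D' a hull subdomain, φ chordal uniformizing, Φ the restriction map of A =
φ.pullbackHull D' with derivative d, μ(range ⊆ closure D') = ofReal(d^(5/8)) (in tree:
sle_restriction_eightThirds_holds + HullRestrictionNull + IsStarHull.pullbackHull). [difficulty:
provable-now] [LawlerSchrammWerner2003Restriction]
#9 AvoidanceDeterminesLaw (support) — (shared verbatim with
SAWRestrictionRigidity.AvoidanceDeterminesLaw, stmt-CriticalPhenomena-1373) two probability measures
on CurveClass ℂ carried by simple chords of D from a to b meeting ∂D only at a, b that give the same
mass to {range ⊆ closure D'} for every hull subdomain D' are equal (curve-space form of LSW03 §3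
'the law of K is determined by P[K ∩ A = ∅]'; π-system of filled hull complements, Lusin–Souslin for
γ ↦ range). [difficulty: M] [LawlerSchrammWerner2003Restriction, AizenmanBurchard1999]
#9 HexApproxExists (support) — (shared verbatim with SAWBetheAnsatz.HexApproxExists,
stmt-CriticalPhenomena-5001) every Dobrushin domain admits a hexagonal-lattice endpoint
approximation (IsEmbEndpointApprox hexGraph hexCenter D a b: points of the largest component Ω_δ ⊆
δℍ joined in Ω_δ for small δ, converging to the two marked prime ends; accessibility of boundary
points of Jordan domains). [difficulty: M] [DuminilCopinSmirnov2012,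
Literature.Probability.RandomPlanarGeometry.SAW.IsEmbEndpointApprox]

TWO-LAYER PLAN. HexRestrictionLaw ⇐ ConformalTowers → KooSaleurVirasoro → WardHadamard →
HexRestrictionLaw (k = 3; the three children are
filed INFORMAL right after open at ranks 5, 3, 4 and receive signatures once the definition requests
HexONTransferMatrix /
VirasoroModuleC0 / KooSaleurConvergence land; then `route edit --split HexRestrictionLaw`). Glue in
words: ConformalTowers
identifies, sector by sector (k = 0, 1, 2 through-lines, free boundaries), the scaling states of the
n = 0 honeycomb
transfer matrix with the graded pieces of the c = 0 modules 𝒱_k (h = 0, 5/8, 2; Kac characters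
χ_(k+1,1)); KooSaleurVirasoro
upgrades this to convergence of the lattice Virasoro modes on those states (the boundary stress
tensor T exists as an
emergent field, with c = 0 and L_0-weight 5/8 on the one-leg state); WardHadamard turns matrix
elements into the boundary
Ward identity for the two-leg partition function Z(Ω; a, b) with one T insertion, integrates δ log Z
= ∮ ν⟨T⟩ along a
smooth path of hull subdomains from D to D' (no Schwarzian term at c = 0; Z(Ω) ≡ 1 for SAW), and
uses the exact
domain-restriction property of the x_c-weights to read the result as HexRestrictionLaw. Foreseen
further:
HexSimpleSubseqLimits ⇐ (simple boundary-avoiding RANGE: HexRestrictionLaw + filled-range Lemma 3.2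
+ SLE simplicity) ∧ (no
retracing: a near-self-approach bound); HexEventualTight ⇐ arm-separation on Hex →
Aizenman–Burchard/KS regularity (shared
with SAWBetheAnsatz's plan).

KILL CRITERIA. (i) ¬HexRestrictionLaw with a DIFFERENT limit value for some smooth hull subdomain
(e.g. Monte-Carlo / exact enumeration of
x_c-SAW in a half-disc avoiding a boundary semicircle, against (1 − r²/x²)^(5/8)-type values)
refutes LSW's restriction
prediction on Hex as typed and closes this route `refuted:HexRestrictionLaw` (and breaks every
hex-restriction line);
non-existence of the limit only for pathological endpoint approximations ⇒ restate with
boundary-vertex endpoints (pivot,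
shared with EndpointRobust of SAWConfRestriction). (ii) MECHANISM: exact diagonalisation (widths L ≤
12) of the n = 0 dilute
honeycomb transfer matrix in the 0- and 1-leg sectors with Koo–Saleur / Milsted–Vidal extraction —
if the effective central
charge does not drift to 0, or ⟨5/8| l_1 l_(−1) |5/8⟩/⟨5/8|5/8⟩ does not drift to 2h = 5/4, or the
level-2 combination
((4/3) l_(−1)² − 2 l_(−2))|5/8⟩ does not decouple (its pairings with level-2 scaling states ↛ 0),
then KooSaleurVirasoro /
WardHadamard are dead in the only sector that matters: close `refuted-in-mechanism` with the
numerics as census unless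
HexRestrictionLaw is by then carried by another hex route (then `superseded --by` that route). (iii)
¬LatticeUniversality,
¬HexEventualTight or ¬HexSimpleSubseqLimits refute much more than this route (the conjunct as
approached from Hex): no
pivot, close. (iv) If SAWHexUniversality's HexConjecture (stmt-CriticalPhenomena-0808) closes by
other means, R_H/S_H/T_H
are mooted and the route reduces to its stand-alone by-products (lattice Virasoro statements), to be
re-filed as Literature
targets, not kept as a route.

NOT DECOMPOSED YET. Everything inside the three informal cruxes: the precise dilute-TL /
Izergin–Korepin presentation of the honeycomb row
transfer matrix and its Hamiltonian limit, the Bethe-ansatz values of e_∞ and of the sound velocity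
v_s entering the
Koo–Saleur normalisation, the choice of 'scaling states' as generalised eigenvectors (Jordan cells
at n = 0), the module
structure of 𝒱_k at c = 0 (which quotient of the h = 5/8 Verma module; b = 5/6 staggered partner of
T in the k = 0/2
sectors), the passage from strip/rectangle Ward identities to curved Jordan boundaries and the
exchange of L → ∞ with the
domain variation (all layer-2 or deeper, after the definitions land). Also not decomposed: endpoint
/ largest-component
bookkeeping inside HexRestrictionLaw, the two halves of HexSimpleSubseqLimits, arm separation behind
HexEventualTight, and
the Schramm-formula / multi-SAW (BPZ level-2) consequences of the same Virasoro structure —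
candidate typed TEST statements
(P^Hex[γ passes left of φ(re^(iθ))] → (1 + cos θ)/2 for κ = 8/3) deliberately left unfiled to keep
the route thin. No
Target decl: X_V is literally the conjunction of HexRestrictionLaw, HexSimpleSubseqLimits,
HexEventualTight, LatticeUniversality.

CHEAPEST FALSIFIER. Kill criterion (ii) is the cheapest check of the MECHANISM (kit, hours: sparse
transfer matrices of x_c-weighted partial-SAW
configurations on honeycomb strips of width ≤ 10–12 with k = 0, 1 through-lines; Koo–Saleur modes
with BA normalisations;
Milsted–Vidal diagnostics) — not run in this one-shot planning seat (no kit job submitted); it is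
the refuter's first move,
together with the LOOKUP 'has the Koo–Saleur programme already been run on the DILUTE n = 0 chain?'
(searched today:
crossref / zbMATH / galaxy find dense-TL / Potts / XXZ instances — doi:10.1007/jhep10(2020)109,
doi:10.1007/jhep02(2021)130,
KooSaleur1994 — and c = 0 dilute-polymer b-measurements DubailJacobsenSaleur2010, but no dilute
Koo–Saleur extraction; a
positive find would make KooSaleurVirasoro's numerics `known` and sharpen its statement, not kill
the line). The cheapest
check of the TYPED hinge is kill criterion (i): Kennedy-style simulation of x_c-SAW on Hex in a
half-disc with a boundary
semicircle removed (Kennedy2002 / Kennedy2004 confirmed SLE_(8/3) restriction-type predictions for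
ℤ² half-plane SAW at the
percent level; no hexagonal run is in print to my knowledge).

NUMBERS. x_c(Hex) = 1/√(2+√2) = 0.5411961 (DuminilCopinSmirnov2012 Thm 1; in tree
DuminilCopinSmirnov2012_thm1_holds). c = 0;
Kac weights at c = 0: h_(r,s) = ((3r−2s)²−1)/24, boundary k-leg (watermelon) weights h_(k+1,1) =
k(3k+2)/8: 5/8, 2, 33/8
(k = 1, 2, 3); h_(1,3) = 1/3 (bulk energy / two-leg); all proved numerology in
Literature.Barriers.CriticalPhenomena.UnitaryCFT
(kacWeightZero_values, sleBoundaryWeight_saw). SLE dictionary: h_(2,1) = (6−κ)/(2κ) = 5/8 and c =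
(3κ−8)(6−κ)/(2κ) = 0 at
κ = 8/3 (Cardy2005SLE §5.3). Restriction exponent 5/8: P[γ ∩ A = ∅] = Φ'_A(0)^(5/8)
(LawlerSchrammWerner2003Restriction
Thm 6.1; sle_restriction_eightThirds_holds); semicircle hull of radius r at boundary point x:
Φ'_A(0) = 1 − r²/x², so
P[hit] ≈ (5/8) r²/x² (FriedrichWerner2003: T as rescaled bump probability). Indecomposability
parameter of dilute polymers
b = 5/6 vs percolation −5/8 (DubailJacobsenSaleur2010; GurarieLudwig2005). Koo–Saleur targets in the
1-leg sector:
⟨h|l_1 l_(−1)|h⟩/⟨h|h⟩ → 2h = 5/4; level-2 null combination for κ = 8/3: (κ/2) L_(−1)² − 2L_(−2) =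
(4/3)L_(−1)² − 2L_(−2)
(BauerBernard2003, Cardy2005SLE §5.3). Kac character of 𝒱_1: q^(5/8)(1−q²)/∏(1−q^m), level
multiplicities 1,1,1,2,3,4,6
(finitized Kac characters of logarithmic minimal-model type, hep-th/0607232). Items at open: 10 (2
typed cruxes + 7 supports
+ assembly); + 3 informal cruxes and 3 definition requests filed right after open = 13 items.

DEFINITION REQUESTS. Filed right after open with `ledger workitem add --kind definition … --for
<KooSaleurVirasoro item>`:
(D1) HexONTransferMatrix (topic Literature/Probability/LatticeModels): the row-to-row transfer
matrix of the honeycomb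
O(n) loop model / x-weighted SAW on a strip of width L with free boundaries, acting on link patterns
with k marked
through-lines (sectors k = 0, 1, 2, …), its identification at n = 0, x = x_c with sums over partial
SAW configurations
(so that strip partition functions of SAWBetheAnsatz.StripGapFiveEighths are its matrix elements),
and its expression in
dilute Temperley–Lieb generators (Nienhuis 1990 / Grimm–Pearce presentation) with the integrable
Hamiltonian limit.
(D2) VirasoroModuleC0 (topic Literature/RepresentationTheory): a plain (non-unitary) representation
of the Virasoro algebra
on a complex vector space (the barrier file has only the inner-product version UnitaryVirasoroRep),
Verma / Kac quotient
modules, and the c = 0 modules 𝒱_k of weights h_(k+1,1) (with the staggered / logarithmic option for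
k = 0, 2:
Kytölä–Ridout staggered modules, b-parameter).
(D3) KooSaleurConvergence (topic Literature/MathematicalPhysics/StatisticalMechanics): Koo–Saleur
lattice modes l_n^(L) of an
open critical chain from local Hamiltonian densities (KooSaleur1994 §3 formula, open-chain version;
normalisations e_∞, v_s
as parameters) and the GJS 'scaling-weak convergence' of (H_L, l_n^(L)) restricted to the lowest-N
scaling states to a
graded Virasoro module (doi:10.1007/jhep10(2020)109 §2–3), formulated on generalised eigenspaces.
Cite facts that would help provers (kind cite, later, not load-bearing): Friedrich–Werner 2003
(boundary T of restriction
measures as ε^(−2)-rescaled bump probabilities; FriedrichWerner2003); Doyon–Riva–Cardy 2006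
(identification of T through
conformal restriction in SLE_(8/3); doi:10.1007/s00220-006-0106-1).

Novelty: Searches (2026-08-15, this seat): `lit search --hybrid "Koo Saleur Virasoro algebra lattice models
Temperley-Lieb"` (12 held
books: Kauffman, Gómez–Ruiz-Altaba–Sierra, Evans–Kawahigashi, Kac, DMS, Iohara–Koga, Jacobsen ch. 14
of
book:editornd-polygons-polyominoes-polycubes — background, no polymer Koo–Saleur); `lit search
--source zbmath "Virasoro
algebra lattice Temperley-Lieb scaling limit"` (6: KooSaleur1994, hep-th/0607232, arXiv:1507.04193
dimers, arXiv:2207.12772,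
arXiv:1907.07610, arXiv:1312.6763); `--source zbmath "dilute Temperley-Lieb Virasoro Koo-Saleur O(n)
model"` (0);
`lit search --source crossref "action of the Virasoro algebra loop models Koo-Saleur generators"`
(15:
doi:10.1007/jhep10(2020)109, doi:10.1007/jhep02(2021)130, doi:10.1016/j.nuclphysb.2013.04.017 blob /
indecomposable Virasoro,
doi:10.1016/j.nuclphysb.2007.06.029 conformal boundary loop models); crossref "Doyon conformal loop
ensembles stress-energy
tensor" (doi:10.1007/s11005-012-0594-1, doi:10.1007/s00220-006-0106-1); crossref "Hongler Kytola
Viklund Virasoro structure"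
(doi:10.1007/s00220-022-04475-x); crossref "Zini Wang anyonic chains"
(doi:10.1007/s00220-018-3254-1); `lit galaxy search
"Koo-Saleur generators" --star all` (1 irrelevant pdf), `"lattice Virasoro algebra" --star all` (3
irrelevant); `lit read
arxiv:hep-th/9312156` (READ §3: the l_n formula and the P Vir P conjecture quoted in § Why this
line); openalex / arXiv / S2
cascades rate-limited today (HTTP 429, logged); plus the card's  [refs: 10.1007/jhep10(2020, 10.1007/jhep02(2021, 10.1016/j.nuclphysb.2013.04.017, 10.1016/j.nuclphysb.2007.06.029, 10.1007/s11005-012-0594-1, 10.1007/s00220-006-0106-1, 10.1007/s00220-022-04475-x, 10.1007/s00220-018-3254-1, 1507.04193, 2207.12772, 1907.07610, 1312.6763, hep-th/9312156, book:editornd-polygons-polyominoes-polycubes, doi:10.1007/jhep10, doi:10.1007/jhep02, doi:10.1016/j.nuclphysb.2013.04.01]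

Barriers (technique_class: lattice-virasoro, koo-saleur, ward-hadamard): - technique_class: lattice-virasoro, koo-saleur, ward-hadamard
- Literature.Barriers.CriticalPhenomena.ParafermionicHalfCauchyRiemann: evaded in letter — no
observable is asked to be discretely holomorphic; T is reconstructed from the algebra of local
transfer-matrix densities (dilute TL at q = i) and holomorphicity is a property of the LIMIT
representation; honest caveat (card): the same information deficit may resurface as non-convergence
of Koo–Saleur modes, which is why KooSaleurVirasoro is a crux and kill criterion (ii) exists. HKV's
rigorous lattice Virasoro (doi:10.1007/s00220-022-04475-x) does use discrete holomorphicity and is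
therefore NOT the template here.
- Literature.Barriers.CriticalPhenomena.SAWNoUnitaryCFT: applies head-on and is embraced — the
barrier PROVES that at c = 0 a unitary highest-weight representation with h ≠ 0 is impossible, so
the limit modules 𝒱_k (h = 5/8, 2) must be non-unitary / indecomposable; every convergence statement
(D3) is formulated on generalised eigenspaces without inner-product positivity, and Zini–Wang's
unitary framework is cited as precedent for the SHAPE of the statement only.
- Literature.Barriers.CriticalPhenomena.NienhuisWeightsExcludeVertexSAW: respected — integrability /
dilute-TL structure is used only on the honeycomb lattice at x_c; ℤ² is reached through
LatticeUniversality (a comparison statement, no identity on ℤ²); the card's ℤ²-direct Milsted–Vidal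
variant is not filed.
- Literature.Barriers.CriticalPhenomena.Embed

sub-problem: SAWScalingLimit · status: done · opened planner-plancard-CriticalPhenomena-SAWScaling-b4daa1a6-0 2026-08-15T12:04:23Z · rev 0 · ledger route-CriticalPhenomena-SAWLatticeVirasoro
GENERATED by the gate from the ledger (D-0016/17). Provers cite these decls: `theorem foo : Summit.CriticalPhenomena.SAWScalingLimit.Theses.SAWLatticeVirasoro.<Decl> := …` in Summits/CriticalPhenomena/SAWScalingLimit/Theorems/<Name>.lean.
-/

namespace Summit.CriticalPhenomena.SAWScalingLimit.Theses.SAWLatticeVirasoro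

open scoped BigOperators Topology Manifold Classical MeasureTheory ProbabilityTheory Matrix InnerProductSpace ComplexConjugate ContinuousMap
open Filter Set Function TopologicalSpace MeasureTheory

attribute [summit_statement] _root_.SAWScalingLimit

/-- item stmt-CriticalPhenomena-7147 · crux · rank 2 · open · by planner
why it might fail: Value and existence for EVERY IsEmbEndpointApprox: mesoscopic-depth endpoints (Kennedy–Lawler lattice effects) or boundary-touching walks (closed event {range ⊆ cl D'} vs Z(Ω'_δ)/Z(Ω_δ)) could shift the limit; on Hex only x_c is a theorem, no exponent is.
sources: LawlerSchrammWerner2004SAW, LawlerSchrammWerner2003Restriction, DuminilCopinSmirnov2012, KennedyLawler2013, Kennedy2004, FriedrichWerner2003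
[crux] (R_H) the LSW restriction law for the critical hexagonal SAW — for every Dobrushin D, hull
subdomain D' (D' ⊆ D, same marked points, D' ∩ B(a,ε) = D ∩ B(a,ε) and likewise at b for some ε >
0), hexagonal endpoint approximation (a_δ, b_δ) (IsEmbEndpointApprox hexGraph hexCenter), chordal
uniformizing φ : ℍ → D and restriction data (Φ, d = Φ'_A(0)) of A = φ.pullbackHull D', the
probability under hexSAWLaw D δ a_δ b_δ that the curve's range lies in closure D' tends to
ENNReal.ofReal (d^(5/8)) as δ → 0+. Lattice meaning: Z_δ(Ω'_δ; a,b)/Z_δ(Ω_δ; a,b) (exact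
domain-restriction property of the x_c-weights) up to boundary-touching walks and largest-component
bookkeeping. Card item (V4) 'PFR(5/8)'; hex twin of SAWLoopFugacityFlow.AvoidanceLimit
(stmt-CriticalPhenomena-4981, on ℤ²). Delivered in this route by ConformalTowers → KooSaleurVirasoro
→ WardHadamard (informal, see Two-layer plan); directly attackable too (any hex method), and the
cheapest thing for refuters to simulate. [difficulty: open-problem] -/
@[route_item "route-CriticalPhenomena-SAWLatticeVirasoro"]
def HexRestrictionLaw : Prop :=
  ∀ (D D' : Literature.Probability.RandomPlanarGeometry.DobrushinDomain) (a b : ℝ → Literature.Probability.LatticeModels.HexVertex), Literature.Probability.RandomPlanarGeometry.SAW.IsEmbEndpointApprox Literature.Probability.LatticeModels.hexGraph Literature.Probability.LatticeModels.hexCenter D a b → D'.carrier ⊆ D.carrier → D'.pt 0 = D.pt 0 → D'.pt 1 = D.pt 1 → (∃ ε : ℝ, 0 < ε ∧ D'.carrier ∩ Metric.ball (D.pt 0) ε = D.carrier ∩ Metric.ball (D.pt 0) ε ∧ D'.carrier ∩ Metric.ball (D.pt 1) ε = D.carrier ∩ Metric.ball (D.pt 1) ε) → ∀ (φ : Literature.Probability.RandomPlanarGeometry.ConformalEquiv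 UpperHalfPlane.upperHalfPlaneSet D.carrier), D.IsChordalUniformizing φ → ∀ (Φ : Literature.Probability.RandomPlanarGeometry.ConformalEquiv (UpperHalfPlane.upperHalfPlaneSet \ φ.pullbackHull D') UpperHalfPlane.upperHalfPlaneSet) (d : ℝ), Literature.Probability.RandomPlanarGeometry.IsRestrictionMap (φ.pullbackHull D') Φ → Literature.Probability.RandomPlanarGeometry.HasRestrictionDeriv (φ.pullbackHull D') Φ d → Filter.Tendsto (fun δ => ((Literature.Probability.RandomPlanarGeometry.SAW.hexSAWLaw D.carrier δ (a δ) (b δ)).map (fun γ => γ.curve)) (Literature.Probability.RandomPlanarGeometry.CurveClass.rangeSubset (closure D'.carrier))) (nhdsWithin 0 (Set.Ioi 0)) (nhds (ENNReal.ofReal (d ^ ((5 : ℝ) / 8))))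

/-- item stmt-CriticalPhenomena-0807 · crux · rank 6 · open · by planner
why it might fail: Uniform ℤ² SAW is in no Yang–Baxter family (GlazmanManolescu2019 p.1; barrier NienhuisWeightsExcludeVertexSAW): no transfer tool reaches it; lattice effects persist in limits of boundary SAW ensembles (KennedyLawler2013); needs tightness on both lattices.
sources: GlazmanManolescu2019, KennedyLawler2013, DuminilCopinSmirnov2012, Literature.Barriers.CriticalPhenomena.NienhuisWeightsExcludeVertexSAW
[crux] r2 (hardest, most informative; informal until defn HexSAWLaw lands): lattice universality of
the chordal critical SAW law — for every Dobrushin domain (Ω; a, b), every square-lattice endpoint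
approximation (a_δ, b_δ) (Literature.Probability.RandomPlanarGeometry.SAW.IsEndpointApprox) and
every hexagonal-lattice endpoint approximation (a'_δ, b'_δ), and every bounded continuous f on
CurveClass ℂ: ∫ f∘curve dP^{Z^2}_{x_c(Z^2),δ} − ∫ f∘curve dP^{Hex}_{x_c(Hex),δ} → 0 as δ → 0+
(x_c(Hex) = 1/√(2+√2), Duminil-Copin–Smirnov 2012 Thm 1). Tool: Yang–Baxter track exchange on
rhombic tilings (Glazman–Manolescu arXiv:1708.00395 §3), which so far controls boundary two-point
functions, not curve laws. -/
@[route_item "route-CriticalPhenomena-SAWLatticeVirasoro"]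
def LatticeUniversality : Prop :=
  ∀ (D : Literature.Probability.RandomPlanarGeometry.DobrushinDomain) (a b : ℝ → Literature.Probability.LatticeModels.Site 2) (a' b' : ℝ → Literature.Probability.LatticeModels.HexVertex), Literature.Probability.RandomPlanarGeometry.SAW.IsEndpointApprox D a b → Literature.Probability.RandomPlanarGeometry.SAW.IsEmbEndpointApprox Literature.Probability.LatticeModels.hexGraph Literature.Probability.LatticeModels.hexCenter D a' b' → ∀ f : BoundedContinuousFunction (Literature.Probability.RandomPlanarGeometry.CurveClass ℂ) ℝ, Filter.Tendsto (fun δ => (∫ γ, f γ.curve ∂(Literature.Probability.RandomPlanarGeometry.SAW.law D.carrier δ (a δ) (b δ))) - ∫ γ, f γ.curve ∂(Literature.Probability.RandomPlanarGeometry.SAW.hexSAWLaw D.carrier δ (a' δ) (b' δ))) (nhdsWithin 0 (Set.Ioi 0)) (nhds 0)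

-- item stmt-CriticalPhenomena-7440 · support · rank 3 · open · by planner — informal only, no Lean statement yet:
--   [crux] (V2 of card lattice-virasoro-koo-saleur; INFORMAL until definitions HexONTransferMatrix /
--   VirasoroModuleC0 / KooSaleurConvergence land) Emergent Virasoro of the critical honeycomb polymer
--   transfer matrix. Let T_L be the row-to-row transfer matrix of the honeycomb O(n = 0) loop model at
--   x_c = 1/√(2+√2) (x_c-weighted self-avoiding through-lines, empty vacuum) on a strip of width L with
--   free (ordinary) boundaries, acting on link states with k marked through-lines, k ∈ {0, 1, 2},
--   written in the dilute Temperley–Lieb algebra dTL_L(n = 0) (q = i), and let H_L = −log T_L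
--   (equivalently the inte

-- item stmt-CriticalPhenomena-7442 · support · rank 4 · open · by planner — informal only, no Lean statement yet:
--   [crux] (V3 ⇒ V4 of card lattice-virasoro-koo-saleur; INFORMAL, the glue child of HexRestrictionLaw)
--   From the lattice Virasoro to the restriction law. Assuming ConformalTowers and KooSaleurVirasoro in
--   the sectors k = 0, 1, 2, show for the critical hexagonal SAW: (i) [boundary Ward identity] the
--   two-leg partition functions Z_δ(Ω; a_δ, b_δ) = Σ_(γ : a_δ → b_δ ⊂ Ω_δ) x_c^ℓ(γ) of lattice
--   rectangles/strips satisfy in the scaling limit the c = 0 boundary Ward identity with one insertion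
--   of the emergent stress tensor T (T realised à la Koo–Saleur as the limit of the local
--   transfer-matrix density at a

-- item stmt-CriticalPhenomena-7458 · support · rank 5 · open · by planner — informal only, no Lean statement yet:
--   [crux] (V1 of card lattice-virasoro-koo-saleur; INFORMAL until definition HexONTransferMatrix lands;
--   the rigorous-Bethe-ansatz target, strictly containing SAWBetheAnsatz.StripGapFiveEighths) Conformal
--   towers of the n = 0 honeycomb strip transfer matrix. With T_L, H_L as in KooSaleurVirasoro (free
--   boundaries, sectors k = 0, 1, 2 through-lines) and E_0(L) = 0 the trivial n = 0 vacuum: for each k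
--   and each cut-off Λ, the multiset of scaled gaps (W_L/π v_s)(E_i^(k)(L) − E_0(L)) below Λ (W_L the
--   strip width in the regular embedding, v_s the Bethe-ansatz sound velocity; generalised eigenvalues
--   counte

/-- item stmt-CriticalPhenomena-1373 · support · rank 9 · closed · proved by Summit.CriticalPhenomena.SAWScalingLimit.Theorems.AvoidanceDeterminesLaw.AvoidanceDeterminesLaw_proof (prover) · by planner
sources: LawlerSchrammWerner2003Restriction, AizenmanBurchard1999
[support] avoidance determines the law: two probability measures on CurveClass ℂ carried by SIMPLE
chords of the Dobrushin domain D from a to b meeting ∂D only at a, b, which give the same mass to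
{range ⊆ closure D'} for every Dobrushin D' ⊆ D with the same marked points and agreeing with D near
a and b (the form delivered by AvoidanceCocycleLimit), are equal (π-system of filled hull
complements generating the Borel sets of simple boundary-avoiding chords: a simple chord is
determined by its range; Lusin–Souslin for γ ↦ range). Planar-topology/measure-theory analogue of
LSW03 §3 ('the law of K is determined by P[K ∩ A = ∅]'); used for uniqueness of subsequential SAW
limits and for uniqueness of the restriction extension to slit domains. Sources:
LawlerSchrammWerner2003Restriction §3, AizenmanBurchard1999 §2.1. -/
@[route_item "route-CriticalPhenomena-SAWLatticeVirasoro"]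
def AvoidanceDeterminesLaw : Prop :=
  ∀ (D : Literature.Probability.RandomPlanarGeometry.DobrushinDomain) (μ ν : MeasureTheory.Measure (Literature.Probability.RandomPlanarGeometry.CurveClass ℂ)), MeasureTheory.IsProbabilityMeasure μ → MeasureTheory.IsProbabilityMeasure ν → (∀ᵐ γ ∂μ, γ ∈ Literature.Probability.RandomPlanarGeometry.CurveClass.simple ∧ γ.source = D.pt 0 ∧ γ.target = D.pt 1 ∧ γ.range ⊆ closure D.carrier ∧ γ.range ∩ frontier D.carrier ⊆ {D.pt 0, D.pt 1}) → (∀ᵐ γ ∂ν, γ ∈ Literature.Probability.RandomPlanarGeometry.CurveClass.simple ∧ γ.source = D.pt 0 ∧ γ.target = D.pt 1 ∧ γ.range ⊆ closure D.carrier ∧ γ.range ∩ frontier D.carrier ⊆ {D.pt 0, D.pt 1}) → (∀ D' : Literature.Probability.RandomPlanarGeometry.DobrushinDomain, D'.carrier ⊆ D.carrier → D'.pt 0 = D.pt 0 → D'.pt 1 = D.pt 1 → (∃ ε : ℝ, 0 < ε ∧ D'.carrier ∩ Metric.ball (D.pt 0) ε = D.carrier ∩ Metric.ball (D.pt 0)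 ε ∧ D'.carrier ∩ Metric.ball (D.pt 1) ε = D.carrier ∩ Metric.ball (D.pt 1) ε) → μ (Literature.Probability.RandomPlanarGeometry.CurveClass.rangeSubset (closure D'.carrier)) = ν (Literature.Probability.RandomPlanarGeometry.CurveClass.rangeSubset (closure D'.carrier))) → μ = ν

/-- `AvoidanceDeterminesLaw` holds: proved by `Summit.CriticalPhenomena.SAWScalingLimit.Theorems.AvoidanceDeterminesLaw.AvoidanceDeterminesLaw_proof`. -/
theorem AvoidanceDeterminesLaw_holds : AvoidanceDeterminesLaw := _root_.Summit.CriticalPhenomena.SAWScalingLimit.Theorems.AvoidanceDeterminesLaw.AvoidanceDeterminesLaw_proof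

/-- item stmt-CriticalPhenomena-4985 · support · rank 9 · closed · proved by Summit.CriticalPhenomena.SAWScalingLimit.Theorems.SLECarrier_proof @ 502abaff2cf7 (prover) · by planner
sources: RohdeSchramm2005, LawlerSchrammWerner2003Restriction, Lawler2005
[support] the chordal SLE_(8/3) law of a Dobrushin domain is a probability measure carried by simple
curve classes from a to b with range in closure D meeting ∂D only at a, b (Rohde–Schramm simplicity
for κ ≤ 4, transience, boundary avoidance; in tree: IsSLELaw.isProbabilityMeasure,
IsSLELaw.ae_simple, IsSLELaw.ae_endpoints, chordalCarrier lemmas, behind the named Rohde–Schramm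
facts). Expected to close from the tree. [difficulty: provable-now] -/
@[route_item "route-CriticalPhenomena-SAWLatticeVirasoro"]
def SLECarrier : Prop :=
  ∀ (D : Literature.Probability.RandomPlanarGeometry.DobrushinDomain) (μ : MeasureTheory.Measure (Literature.Probability.RandomPlanarGeometry.CurveClass ℂ)), Literature.Probability.RandomPlanarGeometry.IsSLELaw ((8 : NNReal) / 3) D μ → MeasureTheory.IsProbabilityMeasure μ ∧ ∀ᵐ γ ∂μ, γ ∈ Literature.Probability.RandomPlanarGeometry.CurveClass.simple ∧ γ.source = D.pt 0 ∧ γ.target = D.pt 1 ∧ γ.range ⊆ closure D.carrier ∧ γ.range ∩ frontier D.carrier ⊆ {D.pt 0, D.pt 1}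

/-- `SLECarrier` holds: proved by `Summit.CriticalPhenomena.SAWScalingLimit.Theorems.SLECarrier_proof` @ 502abaff2cf7. -/
theorem SLECarrier_holds : SLECarrier := _root_.Summit.CriticalPhenomena.SAWScalingLimit.Theorems.SLECarrier_proof

/-- item stmt-CriticalPhenomena-4986 · support · rank 9 · closed · proved by Summit.CriticalPhenomena.SAWScalingLimit.Theorems.SLEAvoidanceValue_pullbackHull_proof @ 20a055b94c44 (prover) · by planner
sources: LawlerSchrammWerner2003Restriction
[support] LSW03 Thm 6.1 transposed to hull subdomains in the ε-ball form used here: for μ the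
chordal SLE_(8/3) law of D, D' ⊆ D agreeing with D near a, b, φ chordal uniformizing, Φ the
restriction map of A = φ.pullbackHull D' with derivative d, μ(range ⊆ closure D') = ofReal(d^(5/8))
(in tree: sle_restriction_eightThirds_holds + HullRestrictionNull '{Γ ⊆ cl D'} and {γ ∩ A = ∅} agree
a.s.' + IsStarHull.pullbackHull). Expected to close from the tree. [difficulty: provable-now] -/
@[route_item "route-CriticalPhenomena-SAWLatticeVirasoro"]
def SLEAvoidanceValue : Prop :=
  ∀ (D D' : Literature.Probability.RandomPlanarGeometry.DobrushinDomain) (μ : MeasureTheory.Measure (Literature.Probability.RandomPlanarGeometry.CurveClass ℂ)), Literature.Probability.RandomPlanarGeometry.IsSLELaw ((8 : NNReal) / 3) D μ → D'.carrier ⊆ D.carrier → D'.pt 0 = D.pt 0 → D'.pt 1 = D.pt 1 → (∃ ε : ℝ, 0 < ε ∧ D'.carrier ∩ Metric.ball (D.pt 0) ε = D.carrier ∩ Metric.ball (D.pt 0) ε ∧ D'.carrier ∩ Metric.ball (D.pt 1) ε = D.carrier ∩ Metric.ball (D.pt 1) ε) → ∀ (φ : Literature.Probability.RandomPlanarGeometry.ConformalEquiv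 UpperHalfPlane.upperHalfPlaneSet D.carrier), D.IsChordalUniformizing φ → ∀ (Φ : Literature.Probability.RandomPlanarGeometry.ConformalEquiv (UpperHalfPlane.upperHalfPlaneSet \ φ.pullbackHull D') UpperHalfPlane.upperHalfPlaneSet) (d : ℝ), Literature.Probability.RandomPlanarGeometry.IsRestrictionMap (φ.pullbackHull D') Φ → Literature.Probability.RandomPlanarGeometry.HasRestrictionDeriv (φ.pullbackHull D') Φ d → μ (Literature.Probability.RandomPlanarGeometry.CurveClass.rangeSubset (closure D'.carrier)) = ENNReal.ofReal (d ^ ((5 : ℝ) / 8))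

/-- `SLEAvoidanceValue` holds: proved by `Summit.CriticalPhenomena.SAWScalingLimit.Theorems.SLEAvoidanceValue_pullbackHull_proof` @ 20a055b94c44. -/
theorem SLEAvoidanceValue_holds : SLEAvoidanceValue := _root_.Summit.CriticalPhenomena.SAWScalingLimit.Theorems.SLEAvoidanceValue_pullbackHull_proof

/-- item stmt-CriticalPhenomena-4997 · support · rank 9 · open · by planner
sources: KemppainenSmirnov2017, AizenmanBurchard1999, DuminilCopinHammond2013, arXiv:2310.17299
[crux] For every Dobrushin domain D and hexagonal endpoint approximation (a_δ, b_δ)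
(IsEmbEndpointApprox hexGraph hexCenter) there is δ₀ > 0 such that the push-forwards to CurveClass ℂ
of the critical hexagonal SAW laws hexSAWLaw D δ a_δ b_δ, δ ∈ (0, δ₀], form a tight set of measures.
Intended proof: annulus k-crossing bounds for x_c-SAW on Hex with exponents λ_k → ∞ (from r3's
rates, even the trivial λ_k ≥ k·λ₁, PLUS an arm-separation/quasi-multiplicativity lemma) fed into
Aizenman–Burchard regularity / Kemppainen–Smirnov Thm 1.5. The ∃δ₀ form avoids the witness that
refuted the all-δ statement stmt-CriticalPhenomena-0772. [deps: CylinderWatermelonGaps] [difficulty: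
open-problem] -/
@[route_item "route-CriticalPhenomena-SAWLatticeVirasoro"]
def HexEventualTight : Prop :=
  ∀ (D : Literature.Probability.RandomPlanarGeometry.DobrushinDomain) (a b : ℝ → Literature.Probability.LatticeModels.HexVertex), Literature.Probability.RandomPlanarGeometry.SAW.IsEmbEndpointApprox Literature.Probability.LatticeModels.hexGraph Literature.Probability.LatticeModels.hexCenter D a b → ∃ δ₀ : ℝ, 0 < δ₀ ∧ MeasureTheory.IsTightMeasureSet ((fun δ : ℝ => (Literature.Probability.RandomPlanarGeometry.SAW.hexSAWLaw D.carrier δ (a δ) (b δ)).map (fun γ => γ.curve)) '' Set.Ioc 0 δ₀)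

/-- item stmt-CriticalPhenomena-5001 · support · rank 9 · open · by planner
sources: DuminilCopinSmirnov2012, Literature.Probability.RandomPlanarGeometry.SAW.IsEmbEndpointApprox
[support] Every Dobrushin domain admits a hexagonal-lattice endpoint approximation: maps a, b : ℝ →
HexVertex with IsEmbEndpointApprox hexGraph hexCenter D a b (points of the largest component Ω_δ ⊆
δℍ joined in Ω_δ for small δ and converging to the two marked prime ends; accessibility of boundary
points of Jordan domains). [difficulty: M] -/
@[route_item "route-CriticalPhenomena-SAWLatticeVirasoro"]
def HexApproxExists : Prop :=
  ∀ D : Literature.Probability.RandomPlanarGeometry.DobrushinDomain, ∃ a b : ℝ → Literature.Probability.LatticeModels.HexVertex, Literature.Probability.RandomPlanarGeometry.SAW.IsEmbEndpointApprox Literature.Probability.LatticeModels.hexGraph Literature.Probability.LatticeModels.hexCenter D a b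

/-- item stmt-CriticalPhenomena-7148 · support · rank 9 · open · by planner
sources: LawlerSchrammWerner2004SAW, KennedyLawler2013, DuminilCopinHammond2013, arXiv:2310.17299, AizenmanBurchard1999
[support] (S_H) for every Dobrushin domain, hexagonal endpoint approximation, sequence s_n → 0+ and
probability measure ν on CurveClass ℂ that is the weak limit of the pushed-forward hexagonal SAW
laws along s_n, ν-a.e. curve class is simple, runs from a = D.pt 0 to b = D.pt 1, has range in
closure D and meets ∂D only at a, b (the carrier clause of AvoidanceDeterminesLaw). Hex twin of
SAWLoopFugacityFlow.SimpleSubseqLimits (stmt-CriticalPhenomena-4982). Load-bearing and believed open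
(no-retracing / no-boundary-crawling bounds at x_c are not in print, only sub-ballisticity); filed
as support because value-free and not specific to this line; foreseen inputs: HexRestrictionLaw +
filled-range Lemma 3.2 + SLE_(8/3) simplicity for the 'simple boundary-avoiding range' half, a
near-self-approach estimate (ConformalTowers' 2-leg weight h_(3,1) = 2 is the CFT reason) for 'no
retracing'. [difficulty: open-problem] -/
@[route_item "route-CriticalPhenomena-SAWLatticeVirasoro"]
def HexSimpleSubseqLimits : Prop :=
  ∀ (D : Literature.Probability.RandomPlanarGeometry.DobrushinDomain) (a b : ℝ → Literature.Probability.LatticeModels.HexVertex), Literature.Probability.RandomPlanarGeometry.SAW.IsEmbEndpointApprox Literature.Probability.LatticeModels.hexGraph Literature.Probability.LatticeModels.hexCenter D a b → ∀ (s : ℕ → ℝ) (ν : MeasureTheory.Measure (Literature.Probability.RandomPlanarGeometry.CurveClass ℂ)), Filter.Tendsto s Filter.atTop (nhdsWithin 0 (Set.Ioi 0)) → MeasureTheory.IsProbabilityMeasure ν → (∀ f : BoundedContinuousFunction (Literature.Probability.RandomPlanarGeometry.CurveClass ℂ) ℝ, Filter.Tendsto (fun n => ∫ γ, f γ.curve ∂(Literature.Probability.RandomPlanarGeometry.SAW.hexSAWLaw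 D.carrier (s n) (a (s n)) (b (s n)))) Filter.atTop (nhds (∫ x, f x ∂ν))) → ∀ᵐ γ ∂ν, γ ∈ Literature.Probability.RandomPlanarGeometry.CurveClass.simple ∧ γ.source = D.pt 0 ∧ γ.target = D.pt 1 ∧ γ.range ⊆ closure D.carrier ∧ γ.range ∩ frontier D.carrier ⊆ {D.pt 0, D.pt 1}

/-- item stmt-CriticalPhenomena-7149 · support · rank 9 · open · by planner
sources: LawlerSchrammWerner2003Restriction, AizenmanBurchard1999
[support] portmanteau sandwich on Hex (twin of SAWLoopFugacityFlow.AvoidancePassage,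
stmt-CriticalPhenomena-4984): if ν is the weak limit of the pushed-forward hexagonal SAW laws along
s_n → 0+, μ is the chordal SLE_(8/3) law of D, and along s_n the SAW avoidance probabilities of
EVERY hull subdomain D'' converge to μ(range ⊆ closure D''), then ν(range ⊆ closure D') = μ(range ⊆
closure D') for every hull subdomain D'. '≥': closed event (CurveClass.isClosed_rangeSubset); '≤':
approximate D' from outside by hull super-domains, open events (isOpen_rangeSubset), lattice curves
live in cl D, continuity from above of μ (or kernel continuity of Φ'_A(0)). Planar topology +
measure theory. [difficulty: M] -/
@[route_item "route-CriticalPhenomena-SAWLatticeVirasoro"]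
def HexAvoidancePassage : Prop :=
  ∀ (D : Literature.Probability.RandomPlanarGeometry.DobrushinDomain) (a b : ℝ → Literature.Probability.LatticeModels.HexVertex), Literature.Probability.RandomPlanarGeometry.SAW.IsEmbEndpointApprox Literature.Probability.LatticeModels.hexGraph Literature.Probability.LatticeModels.hexCenter D a b → ∀ (s : ℕ → ℝ) (ν μ : MeasureTheory.Measure (Literature.Probability.RandomPlanarGeometry.CurveClass ℂ)), Filter.Tendsto s Filter.atTop (nhdsWithin 0 (Set.Ioi 0)) → MeasureTheory.IsProbabilityMeasure ν → (∀ f : BoundedContinuousFunction (Literature.Probability.RandomPlanarGeometry.CurveClass ℂ) ℝ, Filter.Tendsto (fun n => ∫ γ, f γ.curve ∂(Literature.Probability.RandomPlanarGeometry.SAW.hexSAWLaw D.carrier (s n) (a (s n)) (b (s n)))) Filter.atTop (nhds (∫ x, f x ∂ν))) → Literature.Probability.RandomPlanarGeometry.IsSLELaw ((8 : NNReal) / 3) D μ → (∀ D' : Literature.Probability.RandomPlanarGeometry.DobrushinDomain, D'.carrier ⊆ D.carrier → D'.pt 0 = D.pt 0 → D'.pt 1 = D.pt 1 → (∃ ε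 : ℝ, 0 < ε ∧ D'.carrier ∩ Metric.ball (D.pt 0) ε = D.carrier ∩ Metric.ball (D.pt 0) ε ∧ D'.carrier ∩ Metric.ball (D.pt 1) ε = D.carrier ∩ Metric.ball (D.pt 1) ε) → Filter.Tendsto (fun n => ((Literature.Probability.RandomPlanarGeometry.SAW.hexSAWLaw D.carrier (s n) (a (s n)) (b (s n))).map (fun γ => γ.curve)) (Literature.Probability.RandomPlanarGeometry.CurveClass.rangeSubset (closure D'.carrier))) Filter.atTop (nhds (μ (Literature.Probability.RandomPlanarGeometry.CurveClass.rangeSubset (closure D'.carrier))))) → ∀ D' : Literature.Probability.RandomPlanarGeometry.DobrushinDomain, D'.carrier ⊆ D.carrier → D'.pt 0 = D.pt 0 → D'.pt 1 = D.pt 1 → (∃ ε : ℝ, 0 < ε ∧ D'.carrier ∩ Metric.ball (D.pt 0) ε = D.carrier ∩ Metric.ball (D.pt 0) ε ∧ D'.carrier ∩ Metric.ball (D.pt 1) ε = D.carrier ∩ Metric.ball (D.pt 1) ε) → ν (Literature.Probability.RandomPlanarGeometry.CurveClass.rangeSubset (closure D'.carrier)) = μ (Literature.Probability.RandomPlanarGeometry.CurveClass.rangeSubset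 (closure D'.carrier))

/-- item stmt-CriticalPhenomena-7150 · assembly · rank 1 · open · by planner
sources: LawlerSchrammWerner2003Restriction, LawlerSchrammWerner2004SAW, KemppainenSmirnov2017, DuminilCopinSmirnov2012
[assembly] CurveClass.polishSpace → IsSLECurve.map_eq → exists_isSLECurve →
MarkedDomain.exists_isChordalUniformizing → SLECarrier → SLEAvoidanceValue → HexRestrictionLaw →
HexSimpleSubseqLimits → HexAvoidancePassage → AvoidanceDeterminesLaw → HexEventualTight →
LatticeUniversality → HexApproxExists → SAWScalingLimit. -/
@[route_item "route-CriticalPhenomena-SAWLatticeVirasoro"]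
def Assembly : Prop :=
  Literature.Probability.RandomPlanarGeometry.CurveClass.polishSpace (E := ℂ) → Literature.Probability.RandomPlanarGeometry.IsSLECurve.map_eq → Literature.Probability.RandomPlanarGeometry.exists_isSLECurve → Literature.Probability.RandomPlanarGeometry.MarkedDomain.exists_isChordalUniformizing → SLECarrier → SLEAvoidanceValue → HexRestrictionLaw → HexSimpleSubseqLimits → HexAvoidancePassage → AvoidanceDeterminesLaw → HexEventualTight → LatticeUniversality → HexApproxExists → SAWScalingLimit

end Summit.CriticalPhenomena.SAWScalingLimit.Theses.SAWLatticeVirasoro
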